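import Summits.CriticalPhenomena.CardyFormulaZ2.Theorems.CardySelfRefinementLagHandOffNoTouchAuxDict
import Summits.CriticalPhenomena.CardyFormulaZ2.Theorems.CardySelfRefinementLagHandOffNoTouchAuxEvent
import Summits.CriticalPhenomena.CardyFormulaZ2.Theorems.CardySelfRefinementLagHandOffNoTouchAuxWindows
import Summits.CriticalPhenomena.CardyFormulaZ2.Theorems.CardySelfRefinementLagHandOffNoIdle
import HarnessLib

/-!
# No one-sided touching of a fixed axis-parallel line by the limit interface, given a
half-plane three-arm bound (line `hitting-tournament` of crux `LagHandOff`,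
stmt-CriticalPhenomena-10268): the bound along a discretisation family, and the assembly

Serves the registered stubs `stub_quadTransfer_noTouchRe` / `stub_quadTransfer_noTouchIm`
(namespace `Summit.CriticalPhenomena.CardyFormulaZ2.Cruxes.LagHandOff.HittingTournament`) in
CONDITIONAL form, `stub_quadTransfer_noTouchRe_of_threeArm` / `stub_quadTransfer_noTouchIm_of_threeArm`:
GIVEN the cluster-form (undocked) half-plane three-arm bound for critical bond percolation on
`ℤ²` in the four axis directions — (H): there are `C, α > 0`, `c₀ > 0`, `K ≥ 1` such that for
every `u` with `u⁴ = 1`, centre `x`, mesh `δ > 0` and radii `c₀ δ ≤ r`, `K r ≤ R`, the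
probability that the half-annulus of sites `{r ≤ dist (δ v, x) ≤ R, Re (ū (δ v - x)) ≤ 0}`
contains two open crossings (from `dist ≤ 2r` to `dist ≥ R/2`) not joined by an open path of
the half-annulus, or two dual-open ones not dual-joined in it, is at most `C (r/R)^{1+α}`
(Lawler–Schramm–Werner 2002, App. A; the tree's `Z2HalfPlane.real_threeArm_le` is the DOCKED
window form, arms issued from the boundary line, and the inward docking of half-annulus arms
needed to pass from it to (H) is not in the tree) — along positive meshes `δₙ → 0`, every weak
limit `ν` of the interface laws of a `ℤ²`-discretisation family of a Dobrushin domain is carried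
by curve classes no representative of which touches a fixed vertical (resp. horizontal) line
ONE-SIDEDLY at an interior point of `D` while moving both before and after.

* `eventually_measure_approaches_le` — for all small meshes, the probability that the interface
  class has a representative approaching the line `{Re (ū z) = a}` one-sidedly (excursion size
  and depth `d`, closeness `ε`; part 3) is `≤ (2N + 1) C (1024 ε/d)^{1+α}`, `N ≥ Rad/ε`: on
  lattice configurations the exploration polygon approaches the line (`approaches_of_mk_eq`,
  `approaches_reverse`), its near point is within `2ε` of a grid point `p_i = u (a + i ε I)`
  (`exists_int_window`, part 4), around `x_i = p_i + (ε + 6δ) u` it traverses `D(x_i; 4ε, d/4)`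
  in and out at height `≤ -5δ`, far from the discrete boundary, so the dictionary
  `halfAnnulusArms_of_two_traversals` (part 2) puts `ω` in the event of (H) at `x_i` with radii
  `64ε - 3δ`, `d/16 + 3δ`; union bound over the grid;
* `ae_noTouch_of_threeArm` — for `d_j = 1/(j+1)` and `ε_k = d_j 2^{-k}/(4096 K)` these open
  events have bounds tending to `0` with `k` (`tendsto_touchBound_atTop`, part 4), so their
  intersection over `k` is `ν`-null (`measure_iInter_eq_zero_of_eventually_le`), while a
  representative touching one-sidedly at an interior point while moving before and after lies
  in all of them for `d_j` small (`approaches_of_touch`, part 3);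
* the registered forms are the cases `u = ±1` (levels `±x₀`) and `u = ±I` (levels `±y₀`).

References: G. F. Lawler, O. Schramm, W. Werner, Electron. J. Probab. 7 (2002), App. A;
M. Aizenman, A. Burchard, Duke Math. J. 99 (1999), §2, App. A; P. Billingsley, *Convergence
of probability measures* (1999), Thm. 2.1.
-/

noncomputable section

open MeasureTheory Filter Set Topology Metric
open scoped unitInterval BoundedContinuousFunction ENNReal
open Literature.Probability.Percolation Literature.Probability.LatticeModels
open Literature.Probability.RandomPlanarGeometry Literature.Probability.Percolation.QuadCrossing

namespace Summit.CriticalPhenomena.CardyFormulaZ2.Cruxes.LagHandOff.HittingTournament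

/-! ### The bound for the one-sided approach event -/

/-- **The one-sided approach event has half-plane three-arm probability, given a cluster-form
half-plane three-arm bound.** Let `E` be a `ℤ²`-discretisation family of the Dobrushin domain
`D`, `u` a unit vector, and assume the cluster-form half-plane three-arm bound `hH` in the
direction `u` with constants `C, α, c₀, K` (see the module docstring; NOT a theorem of the
tree). Let `0 < ε`, `4096 ε ≤ d`, `1024 K ε ≤ d` and `Rad/ε ≤ N`. Then for all small meshes
`δ`, the probability (critical bond percolation) that the interface class
`bondInterfaceIn D (E δ) ω` has a representative approaching the line `{Re (ū z) = a}`
one-sidedly (excursion size and depth `d`, closeness `ε`, norm `< Rad`) is at most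
`(2N + 1) · C (1024 ε/d)^{1+α}` (module docstring, first item).
[cite: LawlerSchrammWernerEJP2002, Appendix A] [cite: AizenmanBurchardDuke1999, Appendix A] -/
theorem eventually_measure_approaches_le (D : DobrushinDomain) {E : ℝ → DiscreteDobrushin}
    (hE : ZdDiscretisationFamily D E) {u : ℂ} (hu : ‖u‖ = 1) {C α c₀ K : ℝ} (hC : 0 ≤ C)
    (hα : 0 < α) (hc₀ : 0 < c₀) (hK1 : 1 ≤ K)
    (hH : ∀ (x : ℂ) (δ r R : ℝ), 0 < δ → c₀ * δ ≤ r → K * r ≤ R → ∀ S : Set (Site 2),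
      S = {v | r ≤ dist (meshPoint δ v) x ∧ dist (meshPoint δ v) x ≤ R ∧
        (starRingEnd ℂ u * (meshPoint δ v - x)).re ≤ 0} →
      (bondPercolation (zdGraph 2) half).real {ω | ∃ v₁ w₁ v₂ w₂ : Site 2,
        dist (meshPoint δ v₁) x ≤ 2 * r ∧ dist (meshPoint δ v₂) x ≤ 2 * r ∧
        R / 2 ≤ dist (meshPoint δ w₁) x ∧ R / 2 ≤ dist (meshPoint δ w₂) x ∧
        ((ω ∈ openConnIn S v₁ w₁ ∧ ω ∈ openConnIn S v₂ w₂ ∧ ω ∉ openConnIn S v₁ v₂) ∨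
          (dualConfig ω ∈ openConnIn S v₁ w₁ ∧ dualConfig ω ∈ openConnIn S v₂ w₂ ∧
            dualConfig ω ∉ openConnIn S v₁ v₂))} ≤ C * (r / R) ^ (1 + α))
    {a d ε Rad : ℝ} (hε : 0 < ε) (hd : 4096 * ε ≤ d) (hKε : K * (1024 * ε) ≤ d) {N : ℕ}
    (hN : Rad / ε ≤ N) :
    ∀ᶠ δ in 𝓝[>] (0 : ℝ),
      bondPercolation (zdGraph 2) half
          {ω | ∃ c : Curve ℂ, CurveClass.mk c = bondInterfaceIn D (E δ) ω ∧
            ∃ t₁ t₂ t₃ : I, t₁ < t₂ ∧ t₂ < t₃ ∧ d < dist (c t₁) (c t₂) ∧ d < dist (c t₃) (c t₂) ∧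
              |(starRingEnd ℂ u * c t₂).re - a| < ε ∧ d < infDist (c t₂) (frontier D.carrier) ∧
              ‖c t₂‖ < Rad ∧ ∀ r ∈ Icc t₁ t₃, (starRingEnd ℂ u * c r).re < a + ε} ≤
        ((2 * N + 1 : ℕ) : ℝ≥0∞) * ENNReal.ofReal (C * (1024 * ε / d) ^ (1 + α)) := by
  have hdpos : 0 < d := by linarith
  have h1 := hE.eventually_isZdAdmissible
  have hm : 0 < min (ε / 6) (64 * ε / (c₀ + 3)) := lt_min (by positivity) (by positivity)
  have h2 : ∀ᶠ δ in 𝓝[>] (0 : ℝ), δ ≤ min (ε / 6) (64 * ε / (c₀ + 3)) :=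
    mem_nhdsWithin_of_mem_nhds (Iic_mem_nhds hm)
  have h3 : ∀ᶠ δ in 𝓝[>] (0 : ℝ), δ ∈ Ioi (0 : ℝ) := self_mem_nhdsWithin
  filter_upwards [h1, h2, h3] with δ hadm hδle hδpos
  have hδ : 0 < δ := hδpos
  have hδε : δ ≤ ε / 6 := hδle.trans (min_le_left _ _)
  have hδc₀ : δ ≤ 64 * ε / (c₀ + 3) := hδle.trans (min_le_right _ _)
  have hδc₀' : (c₀ + 3) * δ ≤ 64 * ε := by
    rw [le_div_iff₀ (by positivity)] at hδc₀; linarith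
  set P := bondPercolation (zdGraph 2) half with hP
  have hδeq : (E δ).δ = δ := hE.δ_eq δ
  have hΩ : (E δ).Ω = D.carrier := hE.Ω_eq δ
  have hδ' : 0 < (E δ).δ := by rw [hδeq]; exact hδ
  -- the radii of the dictionary and of the three-arm event
  set ρ : ℝ := 4 * ε with hρ
  set R : ℝ := d / 4 with hR
  set rH : ℝ := 16 * ρ - 3 * (E δ).δ with hrH
  set RH : ℝ := R / 4 + 3 * (E δ).δ with hRH
  have hrHpos : 0 < rH := by rw [hrH, hδeq]; linarith
  have hRHpos : 0 < RH := by rw [hRH, hδeq]; positivity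
  have hc₀r : c₀ * (E δ).δ ≤ rH := by rw [hrH, hδeq]; nlinarith
  have hKr : K * rH ≤ RH := by
    rw [hrH, hRH, hδeq]
    have : K * (16 * (4 * ε) - 3 * δ) ≤ K * (64 * ε) := by nlinarith
    linarith
  have hratio : rH / RH ≤ 1024 * ε / d := by
    rw [div_le_div_iff₀ hRHpos hdpos, hrH, hRH, hδeq]
    have h1 : (16 * (4 * ε) - 3 * δ) * d ≤ 64 * ε * d := by nlinarith
    have h2 : 1024 * ε * (d / 4 / 4) ≤ 1024 * ε * (d / 4 / 4 + 3 * δ) := by nlinarith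
    nlinarith
  have hratio0 : 0 ≤ rH / RH := by positivity
  -- the grid points and the shifted centres
  set p : ℤ → ℂ := fun i => u * ((a : ℂ) + (((i : ℝ) * ε : ℝ) : ℂ) * Complex.I) with hp
  set xc : ℤ → ℂ := fun i => p i + ((ε + 6 * δ : ℝ) : ℂ) * u with hxc
  have hpx : ∀ i, dist (p i) (xc i) = ε + 6 * δ := fun i => by
    rw [hxc, Complex.dist_eq]
    simp only
    rw [show p i - (p i + ((ε + 6 * δ : ℝ) : ℂ) * u) = -(((ε + 6 * δ : ℝ) : ℂ) * u) by ring,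
      norm_neg, norm_mul, Complex.norm_real, hu, mul_one, Real.norm_eq_abs,
      abs_of_pos (by positivity)]
  have hheight : ∀ i z, (starRingEnd ℂ u * (z - xc i)).re =
      (starRingEnd ℂ u * z).re - a - (ε + 6 * δ) := fun i z =>
    re_conj_mul_sub_shift hu (re_conj_mul_gridPoint hu a _) z
  -- the three-arm events at the centres
  set S : ℤ → Set (Site 2) := fun i => {v | rH ≤ dist (meshPoint (E δ).δ v) (xc i) ∧
      dist (meshPoint (E δ).δ v) (xc i) ≤ RH ∧
      (starRingEnd ℂ u * (meshPoint (E δ).δ v - xc i)).re ≤ 0} with hS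
  set A : ℤ → Set (BondConfig (Site 2)) := fun i => {ω | ∃ v₁ w₁ v₂ w₂ : Site 2,
      dist (meshPoint (E δ).δ v₁) (xc i) ≤ 2 * rH ∧ dist (meshPoint (E δ).δ v₂) (xc i) ≤ 2 * rH ∧
      RH / 2 ≤ dist (meshPoint (E δ).δ w₁) (xc i) ∧ RH / 2 ≤ dist (meshPoint (E δ).δ w₂) (xc i) ∧
      ((ω ∈ openConnIn (S i) v₁ w₁ ∧ ω ∈ openConnIn (S i) v₂ w₂ ∧ ω ∉ openConnIn (S i) v₁ v₂) ∨
        (dualConfig ω ∈ openConnIn (S i) v₁ w₁ ∧ dualConfig ω ∈ openConnIn (S i) v₂ w₂ ∧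
          dualConfig ω ∉ openConnIn (S i) v₁ v₂))} with hA
  have hPA : ∀ i, P (A i) ≤ ENNReal.ofReal (C * (1024 * ε / d) ^ (1 + α)) := by
    intro i
    rw [← ENNReal.ofReal_toReal (measure_ne_top P (A i))]
    refine ENNReal.ofReal_le_ofReal ?_
    rw [← measureReal_def, hP]
    refine (hH (xc i) (E δ).δ rH RH hδ' hc₀r hKr (S i) rfl).trans ?_
    exact mul_le_mul_of_nonneg_left (Real.rpow_le_rpow hratio0 hratio (by linarith)) hC
  -- the bad event on lattice configurations is covered by the three-arm events
  set T : Finset ℤ := Finset.Icc (-(N : ℤ)) N with hT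
  set B : Set (BondConfig (Site 2)) :=
    {ω | ∃ c : Curve ℂ, CurveClass.mk c = bondInterfaceIn D (E δ) ω ∧
      ∃ t₁ t₂ t₃ : I, t₁ < t₂ ∧ t₂ < t₃ ∧ d < dist (c t₁) (c t₂) ∧ d < dist (c t₃) (c t₂) ∧
        |(starRingEnd ℂ u * c t₂).re - a| < ε ∧ d < infDist (c t₂) (frontier D.carrier) ∧
        ‖c t₂‖ < Rad ∧ ∀ r ∈ Icc t₁ t₃, (starRingEnd ℂ u * c r).re < a + ε} with hB
  set good : Set (BondConfig (Site 2)) := {ω | ω ⊆ (zdGraph 2).edgeSet} with hgooddef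
  have hincl : B ∩ good ⊆ ⋃ i ∈ T, A i := by
    rintro ω ⟨hωB, hωE⟩
    have hωE' : ω ⊆ (zdGraph 2).edgeSet := hωE
    obtain ⟨c, hc, happ⟩ := hωB
    have hexp := isMedialExploration_medialExploration_holds (E δ) hadm ω
    obtain ⟨a₀, l, hal⟩ := List.exists_cons_of_ne_nil hexp.ne_nil
    rw [hal] at hexp
    have hcurve : medialExplorationCurve (E δ) ω =
        polyline ((a₀ :: l).map (medialPoint (E δ).δ)) := by
      rw [medialExplorationCurve, hal]
    have happ1 := approaches_of_mk_eq hu happ (hc.trans (bondInterfaceIn_apply D (E δ) ω))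
    set Γ : Curve ℂ := ⟨polyline ((a₀ :: l).map (medialPoint (E δ).δ))⟩ with hΓ
    have happ2 : ∃ t₁ t₂ t₃ : I, t₁ < t₂ ∧ t₂ < t₃ ∧ d < dist (Γ t₁) (Γ t₂) ∧
        d < dist (Γ t₃) (Γ t₂) ∧ |(starRingEnd ℂ u * Γ t₂).re - a| < ε ∧
        d < infDist (Γ t₂) (frontier D.carrier) ∧ ‖Γ t₂‖ < Rad ∧
        ∀ r ∈ Icc t₁ t₃, (starRingEnd ℂ u * Γ r).re < a + ε := by
      rcases Interface.orientCurve_eq_or D (medialExplorationCurve (E δ) ω) with h | h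
      · rw [h, hcurve] at happ1; exact happ1
      · rw [h] at happ1
        have := approaches_reverse happ1
        rw [Interface.reverseCurve_reverseCurve, hcurve] at this
        exact this
    obtain ⟨t₁, t₂, t₃, h12, h23, hfar1, hfar3, hnear, hdepth, hnorm, harc⟩ := happ2
    have hΓapp : ∀ r, Γ r = polyline ((a₀ :: l).map (medialPoint (E δ).δ)) r := fun r => rfl
    obtain ⟨i, hi1, hi2, hdist⟩ := exists_int_window hu hε hnear hnorm hN
    have hiT : i ∈ T := by rw [hT, Finset.mem_Icc]; exact ⟨hi1, hi2⟩
    have hdx : dist (Γ t₂) (xc i) < 4 * ε := by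
      have := hpx i
      linarith [dist_triangle (Γ t₂) (p i) (xc i)]
    -- one-sidedness relative to the shifted centre
    have hside : ∀ r : I, t₁ ≤ r → r ≤ t₃ →
        (starRingEnd ℂ u * (polyline ((a₀ :: l).map (medialPoint (E δ).δ)) r - xc i)).re ≤
          -(5 * (E δ).δ) := by
      intro r hr1 hr2
      rw [← hΓapp, hheight i (Γ r), hδeq]
      have := harc r ⟨hr1, hr2⟩
      linarith
    have htr₀ : Γ.IsTraversal (xc i) ρ R t₁ t₂ := by
      refine ⟨h12.le, Or.inr ⟨?_, ?_⟩⟩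
      · rw [hR]
        linarith [dist_triangle (Γ t₁) (xc i) (Γ t₂), dist_comm (xc i) (Γ t₂)]
      · rw [hρ]; exact hdx.le
    have htr₁ : Γ.IsTraversal (xc i) ρ R t₂ t₃ := by
      refine ⟨h23.le, Or.inl ⟨?_, ?_⟩⟩
      · rw [hρ]; exact hdx.le
      · rw [hR]
        linarith [dist_triangle (Γ t₃) (xc i) (Γ t₂), dist_comm (xc i) (Γ t₂)]
    -- the discrete boundary is far from the centre
    have hxdepth : 2 * R ≤ infDist (xc i) (frontier D.carrier) := by
      have h1 : infDist (Γ t₂) (frontier D.carrier) ≤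
          infDist (xc i) (frontier D.carrier) + dist (Γ t₂) (xc i) := infDist_le_infDist_add_dist
      rw [hR]; linarith
    have hfar : ∀ v ∈ (E δ).zdBoundary, R ≤ dist (meshPoint (E δ).δ v) (xc i) := fun v hv =>
      le_dist_meshPoint_of_mem_zdBoundary D hΩ hδ' hxdepth (by rw [hδeq, hR]; linarith) hv
    have key := halfAnnulusArms_of_two_traversals hexp hδ' hωE' hu (x := xc i) (ρ := ρ) (R := R)
      (by rw [hδeq, hρ]; linarith) (by rw [hρ, hR]; linarith)
      (fun v hv => hfar v ((E δ).zdArcA_subset_zdBoundary hv))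
      (fun v hv => hfar v ((E δ).zdArcB_subset_zdBoundary hv)) htr₀ htr₁ le_rfl hside
    exact mem_iUnion₂.2 ⟨i, hiT, key⟩
  have hgood : P goodᶜ = 0 := by
    have := ae_subset_edgeSet (zdGraph 2) half
    rw [ae_iff] at this
    exact this
  have hcard : T.card = 2 * N + 1 := by
    rw [hT, Int.card_Icc]
    have : (N : ℤ) + 1 - -(N : ℤ) = ((2 * N + 1 : ℕ) : ℤ) := by push_cast; ring
    rw [this, Int.toNat_natCast]
  calc P B ≤ P (B ∩ good ∪ goodᶜ) := by
        refine measure_mono fun ω hω => ?_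
        by_cases h : ω ∈ good
        · exact Or.inl ⟨hω, h⟩
        · exact Or.inr h
    _ ≤ P (B ∩ good) + P goodᶜ := measure_union_le _ _
    _ = P (B ∩ good) := by rw [hgood, add_zero]
    _ ≤ P (⋃ i ∈ T, A i) := measure_mono hincl
    _ ≤ ∑ i ∈ T, P (A i) := measure_biUnion_finset_le T A
    _ ≤ ∑ i ∈ T, ENNReal.ofReal (C * (1024 * ε / d) ^ (1 + α)) := Finset.sum_le_sum fun i _ => hPA i
    _ = ((2 * N + 1 : ℕ) : ℝ≥0∞) * ENNReal.ofReal (C * (1024 * ε / d) ^ (1 + α)) := by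
        rw [Finset.sum_const, nsmul_eq_mul, hcard]

/-- **Registered sub-stub `stub_noTouch_approachBound`** (line `hitting-tournament`, stubs
`stub_quadTransfer_noTouchRe` / `stub_quadTransfer_noTouchIm`, helper 4):
`eventually_measure_approaches_le` with all arguments explicit.
[cite: LawlerSchrammWernerEJP2002, Appendix A] -/
theorem stub_noTouch_approachBound : ∀ (D : DobrushinDomain) (E : ℝ → DiscreteDobrushin), ZdDiscretisationFamily D E → ∀ (u : ℂ), ‖u‖ = 1 → ∀ (C α c₀ K : ℝ), 0 ≤ C → 0 < α → 0 < c₀ → 1 ≤ K → (∀ (x : ℂ) (δ r R : ℝ), 0 < δ → c₀ * δ ≤ r → K * r ≤ R → ∀ S : Set (Site 2), S = {v | r ≤ dist (meshPoint δ v) x ∧ dist (meshPoint δ v) x ≤ R ∧ (starRingEnd ℂ u * (meshPoint δ v - x)).re ≤ 0} → (bondPercolation (zdGraph 2) half).real {ω | ∃ v₁ w₁ v₂ w₂ : Site 2, dist (meshPoint δ v₁) x ≤ 2 * r ∧ dist (meshPoint δ v₂) x ≤ 2 * r ∧ R / 2 ≤ dist (meshPoint δ w₁) x ∧ R / 2 ≤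 dist (meshPoint δ w₂) x ∧ ((ω ∈ openConnIn S v₁ w₁ ∧ ω ∈ openConnIn S v₂ w₂ ∧ ω ∉ openConnIn S v₁ v₂) ∨ (dualConfig ω ∈ openConnIn S v₁ w₁ ∧ dualConfig ω ∈ openConnIn S v₂ w₂ ∧ dualConfig ω ∉ openConnIn S v₁ v₂))} ≤ C * (r / R) ^ (1 + α)) → ∀ (a d ε Rad : ℝ), 0 < ε → 4096 * ε ≤ d → K * (1024 * ε) ≤ d → ∀ (N : ℕ), Rad / ε ≤ N → ∀ᶠ δ in nhdsWithin (0 : ℝ) (Set.Ioi 0), bondPercolation (zdGraph 2) half {ω | ∃ c : Curve ℂ, CurveClass.mk c = bondInterfaceIn D (E δ) ω ∧ ∃ t₁ t₂ t₃ : unitInterval, t₁ < t₂ ∧ t₂ < t₃ ∧ d < dist (c t₁) (c t₂) ∧ d < dist (c t₃) (c t₂) ∧ |(starRingEnd ℂ u * c t₂).re - a| < ε ∧ d < Metric.infDist (c t₂) (frontier D.carrier) ∧ ‖c t₂‖ < Rad ∧ ∀ r ∈ Set.Icc t₁ t₃, (starRingEnd ℂ u * c r).re < a + ε} ≤ ((2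 * N + 1 : ℕ) : ENNReal) * ENNReal.ofReal (C * (1024 * ε / d) ^ (1 + α)) :=
  fun D _ hE _ hu _ _ _ _ hC hα hc₀ hK1 hH _ _ _ _ hε hd hKε _ hN =>
    eventually_measure_approaches_le D hE hu hC hα hc₀ hK1 hH hε hd hKε hN

/-! ### The statement for a general axis direction -/

/-- **No one-sided touching of the line `{Re (ū z) = a}` at interior points, given the
cluster-form half-plane three-arm bound in the direction `u`.** Along positive meshes
`δₙ → 0`, every weak limit `ν` of the interface laws of a `ℤ²`-discretisation family of
`(D; a, b)` is carried by curve classes all of whose representatives `c` satisfy: if on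
`[s, v]` the curve stays in `{Re (ū z) ≤ a}` and touches the line at a time `t ∈ (s, v)` with
`c t ∈ D`, then `c` is constant on `[s, t]` or on `[t, v]`. See the module docstring.
[cite: LawlerSchrammWernerEJP2002, Appendix A] -/
theorem ae_noTouch_of_threeArm (D : DobrushinDomain) {E : ℝ → DiscreteDobrushin}
    (hE : ZdDiscretisationFamily D E) {δs : ℕ → ℝ} (hpos : ∀ n, 0 < δs n)
    (hlim : Tendsto δs atTop (𝓝 0)) (ν : Measure (CurveClass ℂ)) [IsProbabilityMeasure ν]
    (hconv : ∀ f : CurveClass ℂ →ᵇ ℝ, Tendsto (fun n => ∫ ω, f (bondInterfaceIn D (E (δs n)) ω)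
      ∂(bondPercolation (zdGraph 2) half)) atTop (𝓝 (∫ γ, f γ ∂ν)))
    {u : ℂ} (hu : ‖u‖ = 1) {C α c₀ K : ℝ} (hC : 0 ≤ C) (hα : 0 < α) (hc₀ : 0 < c₀) (hK1 : 1 ≤ K)
    (hH : ∀ (x : ℂ) (δ r R : ℝ), 0 < δ → c₀ * δ ≤ r → K * r ≤ R → ∀ S : Set (Site 2),
      S = {v | r ≤ dist (meshPoint δ v) x ∧ dist (meshPoint δ v) x ≤ R ∧
        (starRingEnd ℂ u * (meshPoint δ v - x)).re ≤ 0} →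
      (bondPercolation (zdGraph 2) half).real {ω | ∃ v₁ w₁ v₂ w₂ : Site 2,
        dist (meshPoint δ v₁) x ≤ 2 * r ∧ dist (meshPoint δ v₂) x ≤ 2 * r ∧
        R / 2 ≤ dist (meshPoint δ w₁) x ∧ R / 2 ≤ dist (meshPoint δ w₂) x ∧
        ((ω ∈ openConnIn S v₁ w₁ ∧ ω ∈ openConnIn S v₂ w₂ ∧ ω ∉ openConnIn S v₁ v₂) ∨
          (dualConfig ω ∈ openConnIn S v₁ w₁ ∧ dualConfig ω ∈ openConnIn S v₂ w₂ ∧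
            dualConfig ω ∉ openConnIn S v₁ v₂))} ≤ C * (r / R) ^ (1 + α)) (a : ℝ) :
    ∀ᵐ γ ∂ν, ∀ c : Curve ℂ, CurveClass.mk c = γ → ∀ s v : I,
      (∀ r ∈ Set.Icc s v, (starRingEnd ℂ u * c r).re ≤ a) → ∀ t ∈ Set.Icc s v,
        (starRingEnd ℂ u * c t).re = a → c t ∈ D.carrier →
          (∀ r ∈ Set.Icc s t, c r = c t) ∨ (∀ r ∈ Set.Icc t v, c r = c t) := by
  classical
  have hδs : Tendsto δs atTop (𝓝[>] 0) :=
    tendsto_nhdsWithin_iff.2 ⟨hlim, Eventually.of_forall hpos⟩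
  have hXm : ∀ n, Measurable (bondInterfaceIn D (E (δs n))) := fun n =>
    Theorems.LagHandOff.Negative.measurable_bondInterfaceIn_family hE (hpos n)
  obtain ⟨Rad₀, hRad₀sub⟩ := D.isBounded.subset_closedBall (0 : ℂ)
  set Rad : ℝ := max Rad₀ 0 + 1 with hRad
  have hRadnn : 0 ≤ Rad := by rw [hRad]; positivity
  have hnormD : ∀ z ∈ D.carrier, ‖z‖ < Rad := fun z hz => by
    have := hRad₀sub hz
    rw [mem_closedBall, dist_zero_right] at this
    rw [hRad]
    linarith [le_max_left Rad₀ 0]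
  ---------------------------------------------------------------- the scales
  set d : ℕ → ℝ := fun j => 1 / ((j : ℝ) + 1) with hddef
  have hdpos : ∀ j, 0 < d j := fun j => by simp only [hddef]; positivity
  set ε₀ : ℕ → ℝ := fun j => d j / (4096 * K) with hε₀def
  have hKpos : 0 < K := by linarith
  have hε₀pos : ∀ j, 0 < ε₀ j := fun j => by simp only [hε₀def]; exact div_pos (hdpos j) (by positivity)
  have hε₀d : ∀ j, 4096 * K * ε₀ j = d j := fun j => by
    simp only [hε₀def]; field_simp
  set ε : ℕ → ℕ → ℝ := fun j k => ε₀ j * (1 / 2) ^ k with hεdef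
  have hεpos : ∀ j k, 0 < ε j k := fun j k => by
    simp only [hεdef]; exact mul_pos (hε₀pos j) (by positivity)
  have hεle : ∀ j k, ε j k ≤ ε₀ j := fun j k => by
    have h1 : (1 / 2 : ℝ) ^ k ≤ 1 := pow_le_one₀ (by norm_num) (by norm_num)
    simp only [hεdef]
    exact mul_le_of_le_one_right (hε₀pos j).le h1
  have hε1 : ∀ j k, 4096 * ε j k ≤ d j := fun j k => by
    have := hεle j k; have := hε₀d j; nlinarith [hεpos j k]
  have hε2 : ∀ j k, K * (1024 * ε j k) ≤ d j := fun j k => by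
    have := hεle j k; have := hε₀d j; nlinarith [hεpos j k]
  set N : ℕ → ℕ → ℕ := fun j k => ⌈Rad / ε j k⌉₊ with hNdef
  have hN : ∀ j k, Rad / ε j k ≤ (N j k : ℝ) := fun j k => Nat.le_ceil _
  ---------------------------------------------------------------- the null events
  set G : ℕ → ℕ → Set (CurveClass ℂ) := fun j k => {γ | ∃ c : Curve ℂ, CurveClass.mk c = γ ∧
    ∃ t₁ t₂ t₃ : I, t₁ < t₂ ∧ t₂ < t₃ ∧ d j < dist (c t₁) (c t₂) ∧ d j < dist (c t₃) (c t₂) ∧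
      |(starRingEnd ℂ u * c t₂).re - a| < ε j k ∧ d j < infDist (c t₂) (frontier D.carrier) ∧
      ‖c t₂‖ < Rad ∧ ∀ r ∈ Icc t₁ t₃, (starRingEnd ℂ u * c r).re < a + ε j k} with hGdef
  have hGopen : ∀ j k, IsOpen (G j k) := fun j k => isOpen_setOf_exists_approaches hu _ _ _ _ _
  have hnull : ∀ j, ν (⋂ k, G j k) = 0 := by
    intro j
    refine measure_iInter_eq_zero_of_eventually_le (X := fun n => bondInterfaceIn D (E (δs n)))
      (P := bondPercolation (zdGraph 2) half) hXm hconv (hGopen j)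
      (b := fun k => ((2 * N j k + 1 : ℕ) : ℝ≥0∞) *
        ENNReal.ofReal (C * (1024 * ε j k / d j) ^ (1 + α))) ?_ ?_
    · intro k
      have hev := hδs.eventually (eventually_measure_approaches_le D hE hu hC hα hc₀ hK1 hH
        (a := a) (Rad := Rad) (hεpos j k) (hε1 j k) (hε2 j k) (hN j k))
      filter_upwards [hev] with n hn
      exact hn
    · exact tendsto_touchBound_atTop hC hα (hdpos j) (hε₀pos j)
        (by have := hε₀d j; nlinarith [hε₀pos j]) hRadnn (fun _ => rfl) (fun _ => rfl)
  have hae : ∀ᵐ γ ∂ν, ∀ j, ∃ k, γ ∉ G j k := by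
    rw [ae_all_iff]
    intro j
    have h := (measure_eq_zero_iff_ae_notMem (μ := ν)).1 (hnull j)
    filter_upwards [h] with γ hγ
    simpa only [mem_iInter, not_forall] using hγ
  ---------------------------------------------------------------- conclusion
  filter_upwards [hae] with γ hG c hc s v hside t ht htouch hD
  by_contra hnot
  obtain ⟨hns, hnv⟩ := not_or.1 hnot
  subst hc
  have hfr_ne : (frontier D.carrier).Nonempty := ⟨D.pt 0, D.pt_mem_frontier 0⟩
  have hnotfr : c t ∉ frontier D.carrier := fun h => by
    have h1 := D.isOpen.inter_frontier_eq
    have : c t ∈ D.carrier ∩ frontier D.carrier := ⟨hD, h⟩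
    rw [h1] at this
    exact this
  have hdepth : 0 < infDist (c t) (frontier D.carrier) :=
    (isClosed_frontier.notMem_iff_infDist_pos hfr_ne).1 hnotfr
  obtain ⟨d₀, hd₀, hmem⟩ := approaches_of_touch (F := frontier D.carrier)
    (fun r hr => hside r hr) htouch hns hnv hdepth (hnormD _ hD)
  obtain ⟨j, hj⟩ := exists_nat_one_div_lt hd₀
  obtain ⟨k, hk⟩ := hG j
  exact hk ⟨c, rfl, hmem (d j) (hdpos j) hj.le (ε j k) (hεpos j k)⟩

/-! ### The registered stubs, conditional on the half-plane three-arm bound -/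

/-- **Registered stub `stub_quadTransfer_noTouchRe`, CONDITIONAL FORM** (line
`hitting-tournament`): given the cluster-form half-plane three-arm bound (H) of the module
docstring, along positive meshes `δₙ → 0` every weak limit `ν` of the interface laws of a
`ℤ²`-discretisation family of `(D; a, b)` is carried by curve classes no representative of
which touches a fixed vertical line `{Re z = x₀}` one-sidedly at an interior point of `D`
while moving both before and after. [cite: LawlerSchrammWernerEJP2002, Appendix A] -/
theorem stub_quadTransfer_noTouchRe_of_threeArm : (∃ C α : ℝ, 0 < C ∧ 0 < α ∧ ∃ c₀ K : ℝ, 0 < c₀ ∧ 1 ≤ K ∧ ∀ u : ℂ, u ^ 4 = 1 → ∀ (x : ℂ) (δ r R : ℝ), 0 < δ → c₀ * δ ≤ r → K * r ≤ R → ∀ S : Set (Site 2), S = {v | r ≤ dist (meshPoint δ v) x ∧ dist (meshPoint δ v) x ≤ R ∧ (starRingEnd ℂ u * (meshPoint δ v - x)).re ≤ 0} → (bondPercolation (zdGraph 2) half).real {ω | ∃ v₁ w₁ v₂ w₂ : Site 2, dist (meshPoint δ v₁) x ≤ 2 * r ∧ dist (meshPoint δ v₂) x ≤ 2 * r ∧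 R / 2 ≤ dist (meshPoint δ w₁) x ∧ R / 2 ≤ dist (meshPoint δ w₂) x ∧ ((ω ∈ openConnIn S v₁ w₁ ∧ ω ∈ openConnIn S v₂ w₂ ∧ ω ∉ openConnIn S v₁ v₂) ∨ (dualConfig ω ∈ openConnIn S v₁ w₁ ∧ dualConfig ω ∈ openConnIn S v₂ w₂ ∧ dualConfig ω ∉ openConnIn S v₁ v₂))} ≤ C * (r / R) ^ (1 + α)) → ∀ (D : DobrushinDomain) (E : ℝ → DiscreteDobrushin), ZdDiscretisationFamily D E → ∀ δs : ℕ → ℝ, (∀ n, 0 < δs n) → Tendsto δs atTop (𝓝 0) → ∀ (ν : Measure (CurveClass ℂ)) [IsProbabilityMeasure ν], (∀ f : CurveClass ℂ →ᵇ ℝ, Tendsto (fun n => ∫ ω, f (bondInterfaceIn D (E (δs n)) ω) ∂(bondPercolation (zdGraph 2) half)) atTop (𝓝 (∫ γ, f γ ∂ν))) → ∀ x₀ : ℝ, ∀ᵐ γ ∂ν, ∀ c : Curve ℂ, CurveClass.mk c = γ → ∀ s u : I, s < u → ((∀ r ∈ Set.Icc s u, (c r).re ≤ x₀) ∨ (∀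 r ∈ Set.Icc s u, x₀ ≤ (c r).re)) → ∀ t ∈ Set.Ioo s u, (c t).re = x₀ → c t ∈ D.carrier → (∀ r ∈ Set.Icc s t, c r = c t) ∨ (∀ r ∈ Set.Icc t u, c r = c t) := by
  rintro ⟨C, α, hC, hα, c₀, K, hc₀, hK1, hH⟩ D E hE δs hpos hlim ν hν hconv x₀
  have h₁ := ae_noTouch_of_threeArm D hE hpos hlim ν hconv (u := 1) (by simp) hC.le hα hc₀ hK1
    (hH 1 (by norm_num)) x₀
  have h₂ := ae_noTouch_of_threeArm D hE hpos hlim ν hconv (u := -1) (by simp) hC.le hα hc₀ hK1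
    (hH (-1) (by norm_num)) (-x₀)
  filter_upwards [h₁, h₂] with γ hγ₁ hγ₂ c hc s u _ hside t ht htouch hD
  rcases hside with hle | hge
  · exact hγ₁ c hc s u (fun r hr => by simpa using hle r hr) t (Ioo_subset_Icc_self ht)
      (by simpa using htouch) hD
  · exact hγ₂ c hc s u (fun r hr => by simpa using hge r hr) t (Ioo_subset_Icc_self ht)
      (by simpa using htouch) hD

/-- **Registered stub `stub_quadTransfer_noTouchIm`, CONDITIONAL FORM** (line
`hitting-tournament`): the horizontal twin — no one-sided touching of a fixed horizontal line
`{Im z = y₀}` at interior points, given (H). [cite: LawlerSchrammWernerEJP2002, Appendix A] -/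
theorem stub_quadTransfer_noTouchIm_of_threeArm : (∃ C α : ℝ, 0 < C ∧ 0 < α ∧ ∃ c₀ K : ℝ, 0 < c₀ ∧ 1 ≤ K ∧ ∀ u : ℂ, u ^ 4 = 1 → ∀ (x : ℂ) (δ r R : ℝ), 0 < δ → c₀ * δ ≤ r → K * r ≤ R → ∀ S : Set (Site 2), S = {v | r ≤ dist (meshPoint δ v) x ∧ dist (meshPoint δ v) x ≤ R ∧ (starRingEnd ℂ u * (meshPoint δ v - x)).re ≤ 0} → (bondPercolation (zdGraph 2) half).real {ω | ∃ v₁ w₁ v₂ w₂ : Site 2, dist (meshPoint δ v₁) x ≤ 2 * r ∧ dist (meshPoint δ v₂) x ≤ 2 * r ∧ R / 2 ≤ dist (meshPoint δ w₁) x ∧ R / 2 ≤ dist (meshPoint δ w₂) x ∧ ((ω ∈ openConnIn S v₁ w₁ ∧ ω ∈ openConnIn S v₂ w₂ ∧ ω ∉ openConnIn S v₁ v₂) ∨ (dualConfig ω ∈ openConnIn S v₁ w₁ ∧ dualConfig ω ∈ openConnIn S v₂ w₂ ∧ dualConfig ω ∉ openConnIn S v₁ v₂))} ≤ C * (r / R)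 ^ (1 + α)) → ∀ (D : DobrushinDomain) (E : ℝ → DiscreteDobrushin), ZdDiscretisationFamily D E → ∀ δs : ℕ → ℝ, (∀ n, 0 < δs n) → Tendsto δs atTop (𝓝 0) → ∀ (ν : Measure (CurveClass ℂ)) [IsProbabilityMeasure ν], (∀ f : CurveClass ℂ →ᵇ ℝ, Tendsto (fun n => ∫ ω, f (bondInterfaceIn D (E (δs n)) ω) ∂(bondPercolation (zdGraph 2) half)) atTop (𝓝 (∫ γ, f γ ∂ν))) → ∀ y₀ : ℝ, ∀ᵐ γ ∂ν, ∀ c : Curve ℂ, CurveClass.mk c = γ → ∀ s u : I, s < u → ((∀ r ∈ Set.Icc s u, (c r).im ≤ y₀) ∨ (∀ r ∈ Set.Icc s u, y₀ ≤ (c r).im)) → ∀ t ∈ Set.Ioo s u, (c t).im = y₀ → c t ∈ D.carrier → (∀ r ∈ Set.Icc s t, c r = c t) ∨ (∀ r ∈ Set.Icc t u, c r = c t) := by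
  rintro ⟨C, α, hC, hα, c₀, K, hc₀, hK1, hH⟩ D E hE δs hpos hlim ν hν hconv y₀
  have hI4 : Complex.I ^ 4 = 1 := by norm_num [pow_succ]
  have hnI4 : (-Complex.I) ^ 4 = 1 := by norm_num [pow_succ]
  have h₁ := ae_noTouch_of_threeArm D hE hpos hlim ν hconv (u := Complex.I) (by simp) hC.le hα
    hc₀ hK1 (hH Complex.I hI4) y₀
  have h₂ := ae_noTouch_of_threeArm D hE hpos hlim ν hconv (u := -Complex.I) (by simp) hC.le hα
    hc₀ hK1 (hH (-Complex.I) hnI4) (-y₀)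
  filter_upwards [h₁, h₂] with γ hγ₁ hγ₂ c hc s u _ hside t ht htouch hD
  rcases hside with hle | hge
  · exact hγ₁ c hc s u (fun r hr => by simpa using hle r hr) t (Ioo_subset_Icc_self ht)
      (by simpa using htouch) hD
  · exact hγ₂ c hc s u (fun r hr => by simpa using hge r hr) t (Ioo_subset_Icc_self ht)
      (by simpa using htouch) hD

end Summit.CriticalPhenomena.CardyFormulaZ2.Cruxes.LagHandOff.HittingTournament

end
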